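import Summits.QuantumFields.BalabanUV.Beta.D1BFx.SplitRecut
import Summits.QuantumFields.BalabanUV.Beta.D1BFx.CornerSummable
import Summits.QuantumFields.BalabanUV.Beta.D1BFx.FineHessianWardKroneckerBlock
import Summits.QuantumFields.BalabanUV.Beta.D1BFx.AssemblyEnd

/-!
# Road BF-x, A7 END OVER THE RE-CUT REST TABLE: the road's target `T` at a block size `n` from (K), (REST′), (U) — (F), (CONV), (SPLIT)
# DISCHARGED; K-R5's `hrow`∕`hT1` replaced by the single first-bond divergence-freeness datum `hdiv`; (CONV) for EVERY re-cut word PROVED here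

Owner file of road «BF-x» (BINDER-OWNERS row D1, co-owner d1-p2, gen 3).  `AssemblyEnd.defect_le_at` (p221972) displays the per-word n-uniform
(REST) bounds over the raw-sector word table `SplitInstance.restK`, whose four longitudinal-class words are presumably unbounded one by one
(FINDING «D1-BFx-LON-MISCUT», journal 2026-08-20 15:31:53Z).  This file is its twin over the RE-CUT table `SplitRecut.restK'` (Feynman-completed
sectors `(SbT, SbL, SbRc)`, cross word over `SbT` — no longitudinal word), with two further integrations of landed swarm modules:

* (F) gluon via `FineHessianWardKroneckerBlock.hF_SbfBal_of_divFree` (gan24-leaf-05-g31, p222532): `hrow` + `hT1` ↦ ONE datum `hdiv`;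
* (CONV) for every re-cut word PROVED (`conv_recut`, from `0 < a`, `Spr (Ga n a)`, the profile's exponential bound, the slot-table sockets;
  the raw ranges by leaf-03-g4's `CornerSummable.conv_restK'` (p223422), the re-cut bubble words and cross word here) — so `hKr` is GONE.

`defect_le_at_recut`: what REMAINS displayed, by name — (K) `hK`+`hω`+`hlam`; the leg binder `Spr (Ga n a)`; the five slot-table sockets; `hdiv`;
the ghost Ward rows `hrowgh`; the frozen profile's exponential bound and evenness; the per-word n-uniform bounds (REST′) `hRest` for the RE-CUT
words; (U).  HONEST STATUS: assembly [folklore]; no cited facts; D1 NOT discharged — (K), (REST′), (U), `hdiv`, `hrowgh` are OPEN hypotheses here.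
HONEST DEPENDENCY: continuum YM on T⁴ ⇐ BetaPertH ∧ nine spine estimates (0/9 proved); BetaPertH ⇐ (D1) ∧ (D4) ∧ CAP+tail; G-an2-4 gates
asym, D1 and NE2/3/4.
-/

noncomputable section

open Finset Filter Topology
open scoped BigOperators
open Literature.MathematicalPhysics.QuantumFieldTheory.Balaban1983to89
open Literature.MathematicalPhysics.QuantumFieldTheory.Balaban1983to89.Beta
open WindowIdentification (fullSum psum exists_tendsto_psum_add)
open B12Sec2to5 (l1)
open DyadicShell (Pt toReal)
open ExpKernelCalculus (Site MKer BiLoc bubble shiftK)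
open SquareTable (stK)
open DressedMomentNormalisation (resSite)
open Summit.QuantumFields.BalabanUV.Beta.TameKernelCalculus (Spr Loc biLoc_of_le)
open Summit.QuantumFields.BalabanUV.Beta.D1BFx.MomentTransferPeriodic (baseKer)
open Summit.QuantumFields.BalabanUV.Beta.D1BFx.GluonLeg (Ga)
open Summit.QuantumFields.BalabanUV.Beta.D1BFx.ReducedKernel (TableR TOfRed)
open Summit.QuantumFields.BalabanUV.Beta.D1BFx.DressedTadpoleTable (tableRed)
open Summit.QuantumFields.BalabanUV.Beta.D1BFx.ReducedKernelSandwich (fineHess)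
open Summit.QuantumFields.BalabanUV.Beta.D1BFx.FineStencilBFBalaban (SbfBal)
open Summit.QuantumFields.BalabanUV.Beta.D1BFx.SecondStencilBF (Wbf)
open Summit.QuantumFields.BalabanUV.Beta.D1BFx.GhostKernelComplete (PghQ fineHessGhQ)
open Summit.QuantumFields.BalabanUV.Beta.D1BFx.WilsonStencilRealised (reixStn ιU)
open Summit.QuantumFields.BalabanUV.Beta.D1BFx.CrossERestLists (vec₀ vecK_eq_realK_vec₀)
open Summit.QuantumFields.BalabanUV.Beta.D1BFx.MainTable (vecK)
open Summit.QuantumFields.BalabanUV.Beta.D1BFx.DressedBubbleBridge (biLoc_const_mono)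
open Summit.QuantumFields.BalabanUV.Beta.D1BFx.PackedKernelSplit (bubble_eq_biBubble)
open Summit.QuantumFields.BalabanUV.Beta.D1BFx.FineHessianSectors (biBubbleTable biBubbleTable_apply absMoment₂_baseKer_biBubbleTable)
open Summit.QuantumFields.BalabanUV.Beta.D1BFx.FineHessianLegGrades (frozenLeg legPiece spr_legPiece spr_frozenLeg)
open Summit.QuantumFields.BalabanUV.Beta.D1BFx.SplitInstance (RestIdx restK)
open Summit.QuantumFields.BalabanUV.Beta.D1BFx.Assembly (abs_defect_le_of_slots exists_tendsto_psum_weight_mul exists_tendsto_psum_const_mul)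
open Summit.QuantumFields.BalabanUV.Beta.D1BFx.AssemblySlots (conv_PghQ hF_PghQ_of_wardRows)
open Summit.QuantumFields.BalabanUV.Beta.D1BFx.AssemblySlotsBal (conv_SbfBal)
open Summit.QuantumFields.BalabanUV.Beta.D1BFx.FineHessianWardKroneckerBlock (hF_SbfBal_of_divFree)
open Summit.QuantumFields.BalabanUV.Beta.D1BFx.RestConv (tendsto_psum_zero)
open Summit.QuantumFields.BalabanUV.Beta.D1BFx.SectorRecut (SbT secSt' secWt' stnConst stnConst_nonneg biLoc_realK exists_biLoc_SbT
  exists_biLoc_secSt')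
open Summit.QuantumFields.BalabanUV.Beta.D1BFx.SplitRecut (restK' restK'_bub restK'_crossE restK'_tad_eq restK'_gtad_eq restK'_gbub_eq
  restK'_corner_eq split_at_basePoint_recut)

namespace Summit.QuantumFields.BalabanUV.Beta.D1BFx.AssemblyEndRecut

/-! ## §1 (CONV) for every re-cut REST word -/

section Conv

variable (n : ℕ) [NeZero n] (a : ℝ) {g : Pt → ℝ} (cE cΛ cR cK cQ cE₂ cJ4 cΛ₂ cR₂ cQ₂ x₀ : ℝ) {WE WJ WΛ WR WQ : TableR}
  (ωgl ωgh lam N : ℝ) {μ ν : Fin 4} (b : Pt) {C δ CE CJ CΛt CRt CQ δW : ℝ}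

/-- [folklore] The model vector vertex family `vecK` is bi-localised at its bond at rate `1` with ONE constant (a finitely supported stencil). -/
theorem exists_biLoc_vecK : ∃ Cs : ℝ, ∀ (κ : Fin 4) (u : Site 4), BiLoc (vecK κ u) u u Cs 1 :=
  ⟨∑ κ : Fin 4, stnConst 1 (reixStn ιU (vec₀ κ)), fun κ u => by
    rw [vecK_eq_realK_vec₀]
    exact biLoc_const_mono (biLoc_realK u u 1 _)
      (single_le_sum (f := fun κ' : Fin 4 => stnConst 1 (reixStn ιU (vec₀ κ'))) (fun _ _ => stnConst_nonneg _ _) (mem_univ κ))⟩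

/-- [folklore] **(CONV) FOR EVERY RE-CUT GRADED BUBBLE WORD** (`0 < a`, `Spr (Ga n a)`, exponentially bounded profile): all 81 word integrands over
the Feynman-completed sectors. -/
theorem conv_biBubbleTable_recut (ha : 0 < a) (hGa : Spr (Ga n a)) (hδ : 0 < δ) (hg : ∀ v, |g v| ≤ C * Real.exp (-δ * l1 v))
    (r r' : Fin 3) (i j : Fin 3) :
    ∃ B, Tendsto (psum (fun w : Pt => ((n : ℝ) ^ 8)⁻¹ * (toReal w μ * toReal w ν *
      baseKer (biBubbleTable (legPiece n a g r) (legPiece n a g r') (secSt' n a cE cR cK cQ i) (secSt' n a cE cR cK cQ j) μ ν) b w))) atTop (𝓝 B) := by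
  obtain ⟨Cs, δs, hδs, hS⟩ := exists_biLoc_secSt' n a cE cR cK cQ ha i
  obtain ⟨Ct, δt, hδt, hT⟩ := exists_biLoc_secSt' n a cE cR cK cQ ha j
  exact exists_tendsto_psum_const_mul _ (exists_tendsto_psum_weight_mul
    (absMoment₂_baseKer_biBubbleTable (legPiece n a g r) (legPiece n a g r') (spr_legPiece n a hGa hδ hg r) (spr_legPiece n a hGa hδ hg r')
      hS hδs hT hδt μ ν b) μ ν)

/-- [folklore] **(CONV) FOR THE RE-CUT CROSS WORD** (exponentially bounded profile): its integrand is `ω_gl·cE²·[n⁻⁸·w_μw_ν·baseKer (biBubbleTable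
(frozenLeg g) (frozenLeg g) SbT SbT μ ν) b w] − ω_gl·cE²·[… vecK vecK …]`, two absolutely second-moment-summable fine bubble words. -/
theorem conv_crossE_recut (hδ : 0 < δ) (hg : ∀ v, |g v| ≤ C * Real.exp (-δ * l1 v)) :
    ∃ B, Tendsto (psum (restK' n a g cE cΛ cR cK cQ cE₂ cJ4 cΛ₂ cR₂ cQ₂ x₀ WE WJ WΛ WR WQ ωgl ωgh lam N μ ν b (Sum.inr (Sum.inr (Sum.inr (Sum.inr 1))))))
      atTop (𝓝 B) := by
  have hA : Spr (frozenLeg g : MKer 4 (Fin 4)) := spr_frozenLeg hδ hg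
  obtain ⟨Cs, δs, hδs, hS⟩ := exists_biLoc_SbT
  obtain ⟨Cv, hV⟩ := exists_biLoc_vecK
  have e : restK' n a g cE cΛ cR cK cQ cE₂ cJ4 cΛ₂ cR₂ cQ₂ x₀ WE WJ WΛ WR WQ ωgl ωgh lam N μ ν b (Sum.inr (Sum.inr (Sum.inr (Sum.inr 1)))) =
      fun w => (ωgl * (cE * cE)) * (((n : ℝ) ^ 8)⁻¹ * (toReal w μ * toReal w ν *
          baseKer (biBubbleTable (frozenLeg g : MKer 4 (Fin 4)) (frozenLeg g) SbT SbT μ ν) b w))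
        + (-(ωgl * (cE * cE))) * (((n : ℝ) ^ 8)⁻¹ * (toReal w μ * toReal w ν *
          baseKer (biBubbleTable (frozenLeg g : MKer 4 (Fin 4)) (frozenLeg g) vecK vecK μ ν) b w)) := by
    funext w
    rw [restK'_crossE, baseKer, baseKer, biBubbleTable_apply, biBubbleTable_apply, ← bubble_eq_biBubble, ← bubble_eq_biBubble]
    ring
  rw [e]
  exact exists_tendsto_psum_add
    (exists_tendsto_psum_const_mul _ (exists_tendsto_psum_const_mul _ (exists_tendsto_psum_weight_mul
      (absMoment₂_baseKer_biBubbleTable (frozenLeg g : MKer 4 (Fin 4)) (frozenLeg g) hA hA hS hδs hS hδs μ ν b) μ ν)))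
    (exists_tendsto_psum_const_mul _ (exists_tendsto_psum_const_mul _ (exists_tendsto_psum_weight_mul
      (absMoment₂_baseKer_biBubbleTable (frozenLeg g : MKer 4 (Fin 4)) (frozenLeg g) hA hA hV one_pos hV one_pos μ ν b) μ ν)))

/-- [folklore] **(CONV) FOR EVERY RE-CUT REST WORD AT FIXED `(n, b)`** (`0 < a`, T1's `Spr (Ga n a)`, exponentially bounded profile, the five slot
tables bi-localised at one rate `δW > 0`, `μ ≠ ν`): the raw ranges by leaf-03-g4's `CornerSummable.conv_restK'`, the re-cut ranges by the two lemmas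
above. -/
theorem conv_recut (ha : 0 < a) (hGa : Spr (Ga n a)) (hδ : 0 < δ) (hg : ∀ v, |g v| ≤ C * Real.exp (-δ * l1 v)) (hδW : 0 < δW)
    (hE : ∀ κ u l u', BiLoc (WE κ u l u') u u' CE δW) (hJ : ∀ κ u l u', BiLoc (WJ κ u l u') u u' CJ δW)
    (hΛ : ∀ κ u l u', BiLoc (WΛ κ u l u') u u' CΛt δW) (hR : ∀ κ u l u', BiLoc (WR κ u l u') u u' CRt δW)
    (hQ : ∀ κ u l u', BiLoc (WQ κ u l u') u u' CQ δW) (hμν : μ ≠ ν) (τ : RestIdx) :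
    ∃ B, Tendsto (psum (restK' n a g cE cΛ cR cK cQ cE₂ cJ4 cΛ₂ cR₂ cQ₂ x₀ WE WJ WΛ WR WQ ωgl ωgh lam N μ ν b τ)) atTop (𝓝 B) := by
  rcases τ with x | x | r | x | k
  · rw [restK'_tad_eq]
    exact CornerSummable.conv_restK' n a cE cΛ cR cK cQ cE₂ cJ4 cΛ₂ cR₂ cQ₂ x₀ ωgl ωgh lam N b ha hGa hδ hg hδW hE hJ hΛ hR hQ hμν _
  · by_cases hx : x = ((0 : Fin 3), (0 : Fin 3), (0 : Fin 3), (0 : Fin 3))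
    · subst hx
      have e : restK' n a g cE cΛ cR cK cQ cE₂ cJ4 cΛ₂ cR₂ cQ₂ x₀ WE WJ WΛ WR WQ ωgl ωgh lam N μ ν b
          (Sum.inr (Sum.inl ((0 : Fin 3), (0 : Fin 3), (0 : Fin 3), (0 : Fin 3)))) = fun _ => 0 := by
        funext w; rw [restK'_bub, if_pos rfl, mul_zero]
      rw [e]; exact tendsto_psum_zero
    · have e : restK' n a g cE cΛ cR cK cQ cE₂ cJ4 cΛ₂ cR₂ cQ₂ x₀ WE WJ WΛ WR WQ ωgl ωgh lam N μ ν b (Sum.inr (Sum.inl x)) = fun w =>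
          ωgl * (secWt' cE cΛ x.1 * secWt' cE cΛ x.2.1 * (((n : ℝ) ^ 8)⁻¹ * (toReal w μ * toReal w ν *
            baseKer (biBubbleTable (legPiece n a g x.2.2.1) (legPiece n a g x.2.2.2) (secSt' n a cE cR cK cQ x.1) (secSt' n a cE cR cK cQ x.2.1)
              μ ν) b w))) := by
        funext w; rw [restK'_bub, if_neg hx]
      rw [e]
      exact exists_tendsto_psum_const_mul _ (exists_tendsto_psum_const_mul _
        (conv_biBubbleTable_recut n a cE cR cK cQ b ha hGa hδ hg x.2.2.1 x.2.2.2 x.1 x.2.1))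
  · rw [restK'_gtad_eq]
    exact CornerSummable.conv_restK' n a cE cΛ cR cK cQ cE₂ cJ4 cΛ₂ cR₂ cQ₂ x₀ ωgl ωgh lam N b ha hGa hδ hg hδW hE hJ hΛ hR hQ hμν _
  · rw [restK'_gbub_eq]
    exact CornerSummable.conv_restK' n a cE cΛ cR cK cQ cE₂ cJ4 cΛ₂ cR₂ cQ₂ x₀ ωgl ωgh lam N b ha hGa hδ hg hδW hE hJ hΛ hR hQ hμν _
  · fin_cases k
    · rw [show ((⟨0, by norm_num⟩ : Fin 2)) = 0 from rfl, restK'_corner_eq]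
      exact CornerSummable.conv_restK' n a cE cΛ cR cK cQ cE₂ cJ4 cΛ₂ cR₂ cQ₂ x₀ ωgl ωgh lam N b ha hGa hδ hg hδW hE hJ hΛ hR hQ hμν _
    · exact conv_crossE_recut n a cE cΛ cR cK cQ cE₂ cJ4 cΛ₂ cR₂ cQ₂ x₀ ωgl ωgh lam N b hδ hg

/-- [folklore] **THE `hKr` HYPOTHESIS OF THE ASSEMBLY FOR THE RE-CUT TABLE, ALL WORDS, EVERY BASE SITE** (site-dependent profile `gp b`), from the END's
own hypotheses. -/
theorem hKr_recut {gp : Pt → Pt → ℝ} (ha : 0 < a) (hGa : Spr (Ga n a))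
    (hg : ∀ b : Pt, ∃ C δ : ℝ, 0 < δ ∧ ∀ v, |gp b v| ≤ C * Real.exp (-δ * l1 v)) (hδW : 0 < δW)
    (hE : ∀ κ u l u', BiLoc (WE κ u l u') u u' CE δW) (hJ : ∀ κ u l u', BiLoc (WJ κ u l u') u u' CJ δW)
    (hΛ : ∀ κ u l u', BiLoc (WΛ κ u l u') u u' CΛt δW) (hR : ∀ κ u l u', BiLoc (WR κ u l u') u u' CRt δW)
    (hQ : ∀ κ u l u', BiLoc (WQ κ u l u') u u' CQ δW) (hμν : μ ≠ ν) :
    ∀ τ : RestIdx, ∀ b ∈ (univ : Finset (Fin 4 → Fin n)).image resSite, ∃ B, Tendsto (psum (fun w : Pt =>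
      restK' n a (gp b) cE cΛ cR cK cQ cE₂ cJ4 cΛ₂ cR₂ cQ₂ x₀ WE WJ WΛ WR WQ ωgl ωgh lam N μ ν b τ w)) atTop (𝓝 B) := by
  intro τ b _
  obtain ⟨C, δ, hδ, hgb⟩ := hg b
  exact conv_recut n a cE cΛ cR cK cQ cE₂ cJ4 cΛ₂ cR₂ cQ₂ x₀ ωgl ωgh lam N b ha hGa hδ hgb hδW hE hJ hΛ hR hQ hμν τ

end Conv

/-! ## §2 The road's defect bound at one block size over the re-cut table -/

section At

variable (n : ℕ) [NeZero n] (a cE cVH cΛ cR cK cQ cE₂ cJ4 cΛ₂ cR₂ cQ₂ x₀ ωgl ωgh lam N : ℝ) {WE WJ WΛ WR WQ : TableR}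
  {CE CJ CΛ CRt CQ δW : ℝ} {gp : Pt → Pt → ℝ} {μ ν : Fin 4} {υ : Type*} [Fintype υ] {c : ℝ} {Ru CU : υ → ℝ} {CR : RestIdx → ℝ}

/-- [folklore] **ROAD BF-x AT BLOCK SIZE `n` (`2 ≤ n`, `Odd n`) OVER THE RE-CUT REST TABLE:
`|c − Σ_{b ∈ image resSite} n⁻⁴·fullSum (stK μ ν N (gp b))| ≤ Σ_u CU u + Σ_τ CR τ`** from (K) the kernel representation of `c` through the two fine-loop
pieces of record with the loop-weight ratio and normalisation, the leg binder, the slot-table sockets, the first-bond divergence-freeness `hdiv` of the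
gluon fine Hessian kernel, the ghost Ward rows, the frozen profile's bound and evenness, the per-word bounds (REST′) for the RE-CUT words `restK'`, and
(U) — slots (F), (CONV) (both fine pieces AND every rest word) and (SPLIT) being DISCHARGED by landed instances. -/
theorem defect_le_at_recut (hn : 2 ≤ n) (hodd : Odd n) (ha : 0 < a) (hμν : μ ≠ ν) (hGa : Spr (Ga n a))
    (hK : c = ωgl * B12Beta.secondMoment (TOfRed n a (SbfBal n a cE cVH cΛ cR cK cQ)
        (tableRed n (Wbf cE₂ cJ4 cΛ₂ cR₂ cQ₂ WE WJ WΛ WR WQ))) μ ν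
      + ωgh * B12Beta.secondMoment (PghQ n a x₀ cK cQ) μ ν + ∑ u, Ru u)
    (hω : ωgh * cK ^ 2 = -2 * (ωgl * cE ^ 2)) (hlam : ωgl * cE ^ 2 = 2 * N ^ 2 * lam)
    (hδW : 0 < δW)
    (hE : ∀ κ u l u', BiLoc (WE κ u l u') u u' CE δW) (hJ : ∀ κ u l u', BiLoc (WJ κ u l u') u u' CJ δW)
    (hΛ : ∀ κ u l u', BiLoc (WΛ κ u l u') u u' CΛ δW) (hR : ∀ κ u l u', BiLoc (WR κ u l u') u u' CRt δW)
    (hQ : ∀ κ u l u', BiLoc (WQ κ u l u') u u' CQ δW)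
    (hEc : ∀ (κ : Fin 4) (u : Site 4) (l : Fin 4) (u' t : Site 4), WE κ (u + (n : ℤ) • t) l (u' + (n : ℤ) • t) = shiftK (-((n : ℤ) • t)) (WE κ u l u'))
    (hJc : ∀ (κ : Fin 4) (u : Site 4) (l : Fin 4) (u' t : Site 4), WJ κ (u + (n : ℤ) • t) l (u' + (n : ℤ) • t) = shiftK (-((n : ℤ) • t)) (WJ κ u l u'))
    (hΛc : ∀ (κ : Fin 4) (u : Site 4) (l : Fin 4) (u' t : Site 4), WΛ κ (u + (n : ℤ) • t) l (u' + (n : ℤ) • t) = shiftK (-((n : ℤ) • t)) (WΛ κ u l u'))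
    (hRc : ∀ (κ : Fin 4) (u : Site 4) (l : Fin 4) (u' t : Site 4), WR κ (u + (n : ℤ) • t) l (u' + (n : ℤ) • t) = shiftK (-((n : ℤ) • t)) (WR κ u l u'))
    (hQc : ∀ (κ : Fin 4) (u : Site 4) (l : Fin 4) (u' t : Site 4), WQ κ (u + (n : ℤ) • t) l (u' + (n : ℤ) • t) = shiftK (-((n : ℤ) • t)) (WQ κ u l u'))
    (hEs : ∀ κ u l u', WE κ u l u' = WE l u' κ u) (hJs : ∀ κ u l u', WJ κ u l u' = WJ l u' κ u) (hΛs : ∀ κ u l u', WΛ κ u l u' = WΛ l u' κ u)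
    (hRs : ∀ κ u l u', WR κ u l u' = WR l u' κ u) (hQs : ∀ κ u l u', WQ κ u l u' = WQ l u' κ u)
    (hdiv : ∀ (l' : Fin 4) (u' u : Site 4), ∑ κ' : Fin 4,
      (fineHess n a (SbfBal n a cE cVH cΛ cR cK cQ) (Wbf cE₂ cJ4 cΛ₂ cR₂ cQ₂ WE WJ WΛ WR WQ) κ' l' (u - Pi.single κ' 1) u'
        - fineHess n a (SbfBal n a cE cVH cΛ cR cK cQ) (Wbf cE₂ cJ4 cΛ₂ cR₂ cQ₂ WE WJ WΛ WR WQ) κ' l' u u') = 0)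
    (hrowgh : ∀ (κ' l' : Fin 4) (b : Site 4), HasSum (fineHessGhQ n a x₀ cK cQ κ' l' b) 0)
    (hg : ∀ b : Pt, ∃ C δ : ℝ, 0 < δ ∧ ∀ v, |gp b v| ≤ C * Real.exp (-δ * l1 v)) (hgev : ∀ b w : Pt, gp b (-w) = gp b w)
    (hRest : ∀ τ : RestIdx, |∑ b ∈ (univ : Finset (Fin 4 → Fin n)).image resSite, ((n : ℝ) ^ 4)⁻¹ * fullSum (fun w : Pt =>
      restK' n a (gp b) cE cΛ cR cK cQ cE₂ cJ4 cΛ₂ cR₂ cQ₂ x₀ WE WJ WΛ WR WQ ωgl ωgh lam N μ ν b τ w)| ≤ CR τ)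
    (hU : ∀ u, |Ru u| ≤ CU u) :
    |c - ∑ b ∈ (univ : Finset (Fin 4 → Fin n)).image resSite, ((n : ℝ) ^ 4)⁻¹ * fullSum (stK μ ν N (gp b))|
      ≤ (∑ u, CU u) + ∑ τ, CR τ := by
  have h1 : 1 ≤ n := le_trans one_le_two hn
  have hEl : ∀ κ u l u', Loc (WE κ u l u') := fun κ u l u' => ⟨u, u', CE, δW, hδW, hE κ u l u'⟩
  have hJl : ∀ κ u l u', Loc (WJ κ u l u') := fun κ u l u' => ⟨u, u', CJ, δW, hδW, hJ κ u l u'⟩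
  have hΛl : ∀ κ u l u', Loc (WΛ κ u l u') := fun κ u l u' => ⟨u, u', CΛ, δW, hδW, hΛ κ u l u'⟩
  have hRl : ∀ κ u l u', Loc (WR κ u l u') := fun κ u l u' => ⟨u, u', CRt, δW, hδW, hR κ u l u'⟩
  have hQl : ∀ κ u l u', Loc (WQ κ u l u') := fun κ u l u' => ⟨u, u', CQ, δW, hδW, hQ κ u l u'⟩
  refine abs_defect_le_of_slots (ι := Fin 2) (T := RestIdx) (υ := υ) (μ := μ) (ν := ν) (N := N) (CU := CU) (CR := CR)
    (c := fun _ => c) (Bset := fun _ => (univ : Finset (Fin 4 → Fin n)).image resSite) (wt := fun _ _ => ((n : ℝ) ^ 4)⁻¹)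
    (Gf := fun _ => gp)
    (P := fun i _ => if i = 0 then TOfRed n a (SbfBal n a cE cVH cΛ cR cK cQ) (tableRed n (Wbf cE₂ cJ4 cΛ₂ cR₂ cQ₂ WE WJ WΛ WR WQ))
      else PghQ n a x₀ cK cQ)
    (ω := fun i _ => if i = 0 then ωgl else ωgh) (R := fun u _ => Ru u)
    (Kf := fun i _ b w => if i = 0 then ((n : ℝ) ^ 8)⁻¹ * (toReal w μ * toReal w ν *
        baseKer (fineHess n a (SbfBal n a cE cVH cΛ cR cK cQ) (Wbf cE₂ cJ4 cΛ₂ cR₂ cQ₂ WE WJ WΛ WR WQ) μ ν) b w)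
      else ((n : ℝ) ^ 8)⁻¹ * (toReal w μ * toReal w ν * baseKer (fineHessGhQ n a x₀ cK cQ μ ν) b w))
    (Kr := fun τ _ b w => restK' n a (gp b) cE cΛ cR cK cQ cE₂ cJ4 cΛ₂ cR₂ cQ₂ x₀ WE WJ WΛ WR WQ ωgl ωgh lam N μ ν b τ w)
    ?_ ?_ ?_ ?_ ?_ ?_ ?_ n hn
  · -- (K)
    intro _ _
    rw [Fin.sum_univ_two]
    simp only [Fin.isValue, if_true, one_ne_zero, if_false]
    exact hK
  · -- (F)
    intro i _ _
    fin_cases i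
    · simp only [Fin.zero_eta, Fin.isValue, if_true]
      exact hF_SbfBal_of_divFree n a cE cVH cΛ cR cK cQ cE₂ cJ4 cΛ₂ cR₂ cQ₂ h1 ha hGa hδW hE hJ hΛ hR hQ hEc hJc hΛc hRc hQc hEs hJs hΛs
        hRs hQs hdiv μ ν
    · simp only [Fin.mk_one, Fin.isValue, one_ne_zero, if_false]
      exact hF_PghQ_of_wardRows n a x₀ cK cQ ha hodd hrowgh μ ν
  · -- (CONV) fine pieces
    intro i _ _
    fin_cases i
    · simp only [Fin.zero_eta, Fin.isValue, if_true]
      exact conv_SbfBal n a cE cVH cΛ cR cK cQ cE₂ cJ4 cΛ₂ cR₂ cQ₂ ha hGa hδW hE hJ hΛ hR hQ μ ν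
    · simp only [Fin.mk_one, Fin.isValue, one_ne_zero, if_false]
      exact conv_PghQ n a x₀ cK cQ ha μ ν
  · -- (CONV) rest words — PROVED for the re-cut table
    intro τ _ _ b hb
    exact hKr_recut n a cE cΛ cR cK cQ cE₂ cJ4 cΛ₂ cR₂ cQ₂ x₀ ωgl ωgh lam N ha hGa hg hδW hE hJ hΛ hR hQ hμν τ b hb
  · -- (SPLIT) for the re-cut table
    intro _ _ b _ w
    rw [Fin.sum_univ_two]
    simp only [Fin.isValue, if_true, one_ne_zero, if_false]
    obtain ⟨C, δ, hδ, hgb⟩ := hg b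
    exact split_at_basePoint_recut n a cE cVH cΛ cR cK cQ cE₂ cJ4 cΛ₂ cR₂ cQ₂ x₀ WE WJ WΛ WR WQ ωgl ωgh lam N μ ν ha hGa hδ hgb (hgev b) hEl hJl
      hΛl hRl hQl hμν hω hlam b w
  · -- (U)
    intro u _ _
    exact hU u
  · -- (REST′)
    intro τ _ _
    exact hRest τ

end At

end Summit.QuantumFields.BalabanUV.Beta.D1BFx.AssemblyEndRecut

end
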